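import Literature.Geometry.Riemannian.IsotropicCurvature
import Literature.Geometry.Lorentzian.LeviCivitaCurvature
import HarnessLib

/-!
# Sectional curvature pinching controls the whole curvature tensor (Berger–Karcher type estimate)

Topic `Literature/Geometry/Riemannian`. Everything here is PROVED; no named facts.

For a pseudo-Riemannian metric `g` on `TM` which is positive definite at the point `x`, and a
Levi-Civita connection `cov` of `g` (`g.IsLeviCivita cov`, `C^n` metric with `n ≥ 2`, so that the
curvature symmetries of `Lorentzian/LeviCivitaCurvature.lean` — skew-adjointness, pair symmetry,
first Bianchi identity — are available), suppose the sectional curvatures at `x` are pinched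
around a constant `c`:

  `|Rm(X, Y, Y, X) - c| ≤ ε` for every `g_x`-orthonormal pair `X, Y`

(`Rm(X,Y,Z,W) = g(R(X,Y)Z, W)`, `PseudoRiemannianMetric.curvatureForm`; on orthonormal pairs
`Rm(X,Y,Y,X) = K(X,Y)`). Then EVERY component of `Rm - c·(g ∧ g)/2` in an orthonormal frame is
`O(ε)`:

* `abs_curvatureForm_pair_sub_le_of_orthogonal` — homogeneous form on orthogonal (not necessarily
  unit) vectors: `|Rm(X,Y,Y,X) - c g(X,X) g(Y,Y)| ≤ ε g(X,X) g(Y,Y)` (multilinearity only; any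
  connection);
* `abs_curvatureForm_three_le` — `|Rm(X, Y, Z, X)| ≤ 2ε` for pairwise orthonormal `X, Y, Z`
  (polarisation `Y ↦ Y + Z` and pair symmetry);
* `abs_curvatureForm_four_le` — `|Rm(X, Y, Z, W)| ≤ 8ε` for pairwise orthonormal `X, Y, Z, W`
  (polarisation `(X, Y) ↦ (X + W, Y + Z)` in three arrangements and the first Bianchi identity);
* `abs_curvatureForm_frame_sub_le` — for a `g_x`-orthonormal frame `e` and ALL indices,
  `|Rm(eᵢ, eⱼ, e_k, e_l) - c (δ_il δ_jk - δ_ik δ_jl)| ≤ 8ε`.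

These are the classical Berger estimates with crude constants (Berger 1960; H. Karcher, *A short
proof of Berger's curvature tensor estimates*, Proc. AMS 26 (1970) 642–644, where the sharp
constants `½(Δ-δ)` and `⅔(Δ-δ)` for `δ ≤ K ≤ Δ` are obtained); the underlying fact that the
sectional curvatures determine the curvature tensor is Lee, *Riemannian Manifolds* (2nd ed.),
Prop. 8.36 / O'Neill 1983, Ch. 3, Cor. 3.42 ("if `K = c` on all nondegenerate planes then
`R_{xy}z = c(⟨z,x⟩y - ⟨z,y⟩x)`"). Used by `LiQingShiPinchingProofs.lean` to show that Li–Qing–Shi's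
sectional pinching `|K + 1| ≤ ε` (Trans. AMS 369 (2017), Thm. 1.8) is equivalent to the smallness
of the Weyl tensor that its proof establishes.

## References

* H. Karcher, Proc. Amer. Math. Soc. 26 (1970) 642–644 (Berger's curvature tensor estimates).
* B. O'Neill, *Semi-Riemannian Geometry* (1983), Ch. 3, Prop. 3.36, Cor. 3.42. [ONeill1983]
* J. M. Lee, *Introduction to Riemannian Manifolds*, 2nd ed. (2018), Prop. 8.36. [Lee2018]
-/

noncomputable section

open Bundle
open scoped Manifold ContDiff Topology

namespace Literature.Geometry.Riemannian

open Literature.Geometry.Lorentzian (PseudoRiemannianMetric)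
open Literature.Geometry.Lorentzian.PseudoRiemannianMetric

variable {E : Type*} [NormedAddCommGroup E] [NormedSpace ℝ E] {H : Type*} [TopologicalSpace H]
  {I : ModelWithCorners ℝ E H} {M : Type*} [TopologicalSpace M] [ChartedSpace H M]
  [IsManifold I ∞ M] {n : ℕ∞ω} {x : M}
  {g : PseudoRiemannianMetric I n E (TangentSpace I : M → Type _)}
  {cov : CovariantDerivative I E (TangentSpace I : M → Type _)} {c ε : ℝ}

/-! ### Homogeneous form of the pinching hypothesis -/

/-- **Homogeneous sectional pinching.** If `g_x` is positive definite and
`|Rm(X,Y,Y,X) - c| ≤ ε` for all `g_x`-orthonormal pairs, then for all `g_x`-orthogonal `X, Y`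
(any lengths) `|Rm(X,Y,Y,X) - c g(X,X) g(Y,Y)| ≤ ε g(X,X) g(Y,Y)`: normalise `X, Y` and use
4-linearity of `Rm` (valid for every connection `cov`). [folklore] -/
theorem abs_curvatureForm_pair_sub_le_of_orthogonal
    (hpos : ∀ v : TangentSpace I x, v ≠ 0 → 0 < g.val x v v)
    (hK : ∀ X Y : TangentSpace I x, g.val x X X = 1 → g.val x Y Y = 1 → g.val x X Y = 0 →
      |g.curvatureForm cov x X Y Y X - c| ≤ ε)
    {X Y : TangentSpace I x} (hXY : g.val x X Y = 0) :
    |g.curvatureForm cov x X Y Y X - c * (g.val x X X * g.val x Y Y)| ≤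
      ε * (g.val x X X * g.val x Y Y) := by
  by_cases hX : X = 0
  · subst hX; simp [curvatureForm]
  by_cases hY : Y = 0
  · subst hY; simp [curvatureForm]
  have hp : 0 < g.val x X X := hpos X hX
  have hq : 0 < g.val x Y Y := hpos Y hY
  set a := Real.sqrt (g.val x X X) with ha_def
  set b := Real.sqrt (g.val x Y Y) with hb_def
  have ha : 0 < a := Real.sqrt_pos.2 hp
  have hb : 0 < b := Real.sqrt_pos.2 hq
  have ha2 : a ^ 2 = g.val x X X := Real.sq_sqrt hp.le
  have hb2 : b ^ 2 = g.val x Y Y := Real.sq_sqrt hq.le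
  have h1 : g.val x (a⁻¹ • X) (a⁻¹ • X) = 1 := by
    simp only [map_smul, smul_apply, smul_eq_mul]
    rw [← ha2]; field_simp
  have h2 : g.val x (b⁻¹ • Y) (b⁻¹ • Y) = 1 := by
    simp only [map_smul, smul_apply, smul_eq_mul]
    rw [← hb2]; field_simp
  have h3 : g.val x (a⁻¹ • X) (b⁻¹ • Y) = 0 := by
    simp only [map_smul, smul_apply, smul_eq_mul, hXY, mul_zero]
  have hR : g.curvatureForm cov x (a⁻¹ • X) (b⁻¹ • Y) (b⁻¹ • Y) (a⁻¹ • X) =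
      (g.val x X X * g.val x Y Y)⁻¹ * g.curvatureForm cov x X Y Y X := by
    simp only [curvatureForm, map_smul, smul_apply, smul_eq_mul]
    rw [← ha2, ← hb2]; field_simp
  have hk := hK _ _ h1 h2 h3
  rw [hR] at hk
  have hpq : 0 < g.val x X X * g.val x Y Y := mul_pos hp hq
  have key : g.curvatureForm cov x X Y Y X - c * (g.val x X X * g.val x Y Y) =
      (g.val x X X * g.val x Y Y) *
        ((g.val x X X * g.val x Y Y)⁻¹ * g.curvatureForm cov x X Y Y X - c) := by
    field_simp
  rw [key, abs_mul, abs_of_pos hpq, mul_comm ε]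
  exact mul_le_mul_of_nonneg_left hk hpq.le

/-! ### Three orthonormal vectors: `|Rm(X, Y, Z, X)| ≤ 2ε` -/

section LeviCivita

variable [FiniteDimensional ℝ E] [CompleteSpace E]

/-- `Rm(X, Z, Y, X) = Rm(X, Y, Z, X)` for a Levi-Civita connection (pair symmetry followed by the
two antisymmetries; O'Neill 1983, Ch. 3, Prop. 3.36). [cite: ONeill1983, Ch. 3, Prop. 3.36] -/
theorem curvatureForm_swap_inner (h : g.IsLeviCivita cov) (hn : 2 ≤ n) (x : M)
    (X Y Z : TangentSpace I x) :
    g.curvatureForm cov x X Z Y X = g.curvatureForm cov x X Y Z X := by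
  simp only [curvatureForm]
  rw [h.val_curvature_pair_symm hn x X Z Y X, val_curvature_antisymm x Y X X Z,
    h.val_curvature_skew hn x X Y X Z, neg_neg]

/-- **Berger–Karcher estimate, three vectors (crude constant).** Under the sectional pinching
`|Rm(X,Y,Y,X) - c| ≤ ε` on `g_x`-orthonormal pairs (`g_x` positive definite, `cov` a Levi-Civita
connection of the `C^n` metric `g`, `n ≥ 2`), every triple of pairwise `g_x`-orthonormal vectors
has `|Rm(X, Y, Z, X)| ≤ 2ε`: polarise the pinching at `(X, Y + Z)` and use
`Rm(X,Z,Y,X) = Rm(X,Y,Z,X)`. (Karcher 1970 has the sharp `|R(X,Y,Z,X)| ≤ ½(Δ - δ)`.) [folklore] -/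
theorem abs_curvatureForm_three_le (h : g.IsLeviCivita cov) (hn : 2 ≤ n)
    (hpos : ∀ v : TangentSpace I x, v ≠ 0 → 0 < g.val x v v)
    (hK : ∀ X Y : TangentSpace I x, g.val x X X = 1 → g.val x Y Y = 1 → g.val x X Y = 0 →
      |g.curvatureForm cov x X Y Y X - c| ≤ ε)
    {X Y Z : TangentSpace I x} (hX : g.val x X X = 1) (hY : g.val x Y Y = 1)
    (hZ : g.val x Z Z = 1) (hXY : g.val x X Y = 0) (hXZ : g.val x X Z = 0)
    (hYZ : g.val x Y Z = 0) :
    |g.curvatureForm cov x X Y Z X| ≤ 2 * ε := by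
  -- polarisation at `(X, Y + Z)`: `g(X, Y+Z) = 0`, `g(Y+Z, Y+Z) = 2`
  have hU : g.val x X (Y + Z) = 0 := by simp [hXY, hXZ]
  have hUU : g.val x (Y + Z) (Y + Z) = 2 := by
    simp only [map_add, add_apply, hY, hZ, hYZ, g.symm x Z Y]
    norm_num
  have hpol := abs_curvatureForm_pair_sub_le_of_orthogonal (cov := cov) hpos hK hU
  rw [hX, hUU] at hpol
  have hexp : g.curvatureForm cov x X (Y + Z) (Y + Z) X =
      g.curvatureForm cov x X Y Y X + g.curvatureForm cov x X Y Z X +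
        g.curvatureForm cov x X Z Y X + g.curvatureForm cov x X Z Z X := by
    simp only [curvatureForm, map_add, add_apply]
    ring
  rw [hexp, curvatureForm_swap_inner h hn x X Y Z] at hpol
  have h1 := abs_le.1 (hK X Y hX hY hXY)
  have h2 := abs_le.1 (hK X Z hX hZ hXZ)
  have h3 := abs_le.1 hpol
  rw [abs_le]
  constructor <;> linarith [h1.1, h1.2, h2.1, h2.2, h3.1, h3.2]

/-- Variant: `|Rm(X, Y, X, Z)| ≤ 2ε` (skew-adjointness in the last pair). [folklore] -/
theorem abs_curvatureForm_three_le' (h : g.IsLeviCivita cov) (hn : 2 ≤ n)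
    (hpos : ∀ v : TangentSpace I x, v ≠ 0 → 0 < g.val x v v)
    (hK : ∀ X Y : TangentSpace I x, g.val x X X = 1 → g.val x Y Y = 1 → g.val x X Y = 0 →
      |g.curvatureForm cov x X Y Y X - c| ≤ ε)
    {X Y Z : TangentSpace I x} (hX : g.val x X X = 1) (hY : g.val x Y Y = 1)
    (hZ : g.val x Z Z = 1) (hXY : g.val x X Y = 0) (hXZ : g.val x X Z = 0)
    (hYZ : g.val x Y Z = 0) :
    |g.curvatureForm cov x X Y X Z| ≤ 2 * ε := by
  have := abs_curvatureForm_three_le h hn hpos hK hX hY hZ hXY hXZ hYZ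
  simp only [curvatureForm] at this ⊢
  rw [h.val_curvature_skew hn x X Y X Z, abs_neg]
  exact this

/-- Variant: `|Rm(X, Y, Y, Z)| ≤ 2ε` for pairwise orthonormal `X, Y, Z` (pair symmetry turns it
into `Rm(Y, Z, X, Y)`). [folklore] -/
theorem abs_curvatureForm_three_le_mid (h : g.IsLeviCivita cov) (hn : 2 ≤ n)
    (hpos : ∀ v : TangentSpace I x, v ≠ 0 → 0 < g.val x v v)
    (hK : ∀ X Y : TangentSpace I x, g.val x X X = 1 → g.val x Y Y = 1 → g.val x X Y = 0 →
      |g.curvatureForm cov x X Y Y X - c| ≤ ε)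
    {X Y Z : TangentSpace I x} (hX : g.val x X X = 1) (hY : g.val x Y Y = 1)
    (hZ : g.val x Z Z = 1) (hXY : g.val x X Y = 0) (hXZ : g.val x X Z = 0)
    (hYZ : g.val x Y Z = 0) :
    |g.curvatureForm cov x X Y Y Z| ≤ 2 * ε := by
  have hYX : g.val x Y X = 0 := by rw [g.symm]; exact hXY
  have hZX : g.val x Z X = 0 := by rw [g.symm]; exact hXZ
  have := abs_curvatureForm_three_le h hn hpos hK hY hZ hX hYZ hYX hZX
  simp only [curvatureForm] at this ⊢
  rw [h.val_curvature_pair_symm hn x X Y Y Z]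
  exact this

/-- Variant: `|Rm(X, Y, Z, Y)| ≤ 2ε` for pairwise orthonormal `X, Y, Z`. [folklore] -/
theorem abs_curvatureForm_three_le_mid' (h : g.IsLeviCivita cov) (hn : 2 ≤ n)
    (hpos : ∀ v : TangentSpace I x, v ≠ 0 → 0 < g.val x v v)
    (hK : ∀ X Y : TangentSpace I x, g.val x X X = 1 → g.val x Y Y = 1 → g.val x X Y = 0 →
      |g.curvatureForm cov x X Y Y X - c| ≤ ε)
    {X Y Z : TangentSpace I x} (hX : g.val x X X = 1) (hY : g.val x Y Y = 1)
    (hZ : g.val x Z Z = 1) (hXY : g.val x X Y = 0) (hXZ : g.val x X Z = 0)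
    (hYZ : g.val x Y Z = 0) :
    |g.curvatureForm cov x X Y Z Y| ≤ 2 * ε := by
  have := abs_curvatureForm_three_le_mid h hn hpos hK hX hY hZ hXY hXZ hYZ
  simp only [curvatureForm] at this ⊢
  rw [h.val_curvature_skew hn x X Y Z Y, abs_neg]
  exact this

/-! ### Four orthonormal vectors: `|Rm(X, Y, Z, W)| ≤ 8ε` -/

/-- The polarisation step: for pairwise `g_x`-orthonormal `X, Y, Z, W`, expanding the pinching at
the orthogonal pair `(X + W, Y + Z)` (`16` terms, reorganised by the curvature symmetries and
bounded by the two- and three-vector estimates) gives `|Rm(X,Y,Z,W) - Rm(X,Z,W,Y)| ≤ 12ε`.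
[folklore] -/
theorem abs_curvatureForm_four_sub_le (h : g.IsLeviCivita cov) (hn : 2 ≤ n)
    (hpos : ∀ v : TangentSpace I x, v ≠ 0 → 0 < g.val x v v)
    (hK : ∀ X Y : TangentSpace I x, g.val x X X = 1 → g.val x Y Y = 1 → g.val x X Y = 0 →
      |g.curvatureForm cov x X Y Y X - c| ≤ ε)
    {X Y Z W : TangentSpace I x} (hX : g.val x X X = 1) (hY : g.val x Y Y = 1)
    (hZ : g.val x Z Z = 1) (hW : g.val x W W = 1) (hXY : g.val x X Y = 0)
    (hXZ : g.val x X Z = 0) (hXW : g.val x X W = 0) (hYZ : g.val x Y Z = 0)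
    (hYW : g.val x Y W = 0) (hZW : g.val x Z W = 0) :
    |g.curvatureForm cov x X Y Z W - g.curvatureForm cov x X Z W Y| ≤ 12 * ε := by
  have hWY : g.val x W Y = 0 := by rw [g.symm]; exact hYW
  have hWZ : g.val x W Z = 0 := by rw [g.symm]; exact hZW
  have hWX : g.val x W X = 0 := by rw [g.symm]; exact hXW
  have hYX : g.val x Y X = 0 := by rw [g.symm]; exact hXY
  have hZX : g.val x Z X = 0 := by rw [g.symm]; exact hXZ
  have hZY : g.val x Z Y = 0 := by rw [g.symm]; exact hYZ
  -- the orthogonal pair `(X + W, Y + Z)`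
  have hU : g.val x (X + W) (Y + Z) = 0 := by
    simp [hXY, hXZ, hWY, hWZ]
  have hUU : g.val x (X + W) (X + W) = 2 := by
    simp only [map_add, add_apply, hX, hW, hXW, hWX]; norm_num
  have hVV : g.val x (Y + Z) (Y + Z) = 2 := by
    simp only [map_add, add_apply, hY, hZ, hYZ, hZY]; norm_num
  have hpol := abs_curvatureForm_pair_sub_le_of_orthogonal (cov := cov) hpos hK hU
  rw [hUU, hVV] at hpol
  have hexp : g.curvatureForm cov x (X + W) (Y + Z) (Y + Z) (X + W) =
      (g.curvatureForm cov x X Y Y X + g.curvatureForm cov x X Y Z X +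
        g.curvatureForm cov x X Z Y X + g.curvatureForm cov x X Z Z X) +
      (g.curvatureForm cov x W Y Y W + g.curvatureForm cov x W Y Z W +
        g.curvatureForm cov x W Z Y W + g.curvatureForm cov x W Z Z W) +
      (g.curvatureForm cov x X Y Y W + g.curvatureForm cov x X Y Z W +
        g.curvatureForm cov x X Z Y W + g.curvatureForm cov x X Z Z W) +
      (g.curvatureForm cov x W Y Y X + g.curvatureForm cov x W Y Z X +
        g.curvatureForm cov x W Z Y X + g.curvatureForm cov x W Z Z X) := by
    simp only [curvatureForm, map_add, add_apply]
    ring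
  -- symmetries
  have s1 := curvatureForm_swap_inner h hn x X Y Z
  have s2 := curvatureForm_swap_inner h hn x W Y Z
  have s3 : g.curvatureForm cov x W Y Y X = g.curvatureForm cov x X Y Y W := by
    simp only [curvatureForm]
    rw [h.val_curvature_pair_symm hn x W Y Y X, val_curvature_antisymm x Y X W Y,
      h.val_curvature_skew hn x X Y W Y, neg_neg]
  have s4 : g.curvatureForm cov x W Z Z X = g.curvatureForm cov x X Z Z W := by
    simp only [curvatureForm]
    rw [h.val_curvature_pair_symm hn x W Z Z X, val_curvature_antisymm x Z X W Z,
      h.val_curvature_skew hn x X Z W Z, neg_neg]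
  have s5 : g.curvatureForm cov x W Y Z X = g.curvatureForm cov x X Z Y W := by
    simp only [curvatureForm]
    rw [h.val_curvature_pair_symm hn x W Y Z X, val_curvature_antisymm x Z X W Y,
      h.val_curvature_skew hn x X Z W Y, neg_neg]
  have s6 : g.curvatureForm cov x W Z Y X = g.curvatureForm cov x X Y Z W := by
    simp only [curvatureForm]
    rw [h.val_curvature_pair_symm hn x W Z Y X, val_curvature_antisymm x Y X W Z,
      h.val_curvature_skew hn x X Y W Z, neg_neg]
  have s7 : g.curvatureForm cov x X Z Y W = - g.curvatureForm cov x X Z W Y := by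
    simp only [curvatureForm]
    rw [h.val_curvature_skew hn x X Z Y W]
  -- two-vector bounds
  have b1 := abs_le.1 (hK X Y hX hY hXY)
  have b2 := abs_le.1 (hK X Z hX hZ hXZ)
  have b3 := abs_le.1 (hK W Y hW hY hWY)
  have b4 := abs_le.1 (hK W Z hW hZ hWZ)
  -- three-vector bounds
  have c1 := abs_le.1 (abs_curvatureForm_three_le h hn hpos hK hX hY hZ hXY hXZ hYZ)
  have c2 := abs_le.1 (abs_curvatureForm_three_le h hn hpos hK hW hY hZ hWY hWZ hYZ)
  have c3 := abs_le.1 (abs_curvatureForm_three_le_mid h hn hpos hK hX hY hW hXY hXW hYW)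
  have c4 := abs_le.1 (abs_curvatureForm_three_le_mid h hn hpos hK hX hZ hW hXZ hXW hZW)
  have hp := abs_le.1 hpol
  rw [hexp] at hp
  rw [abs_le]
  constructor <;> linarith [hp.1, hp.2, b1.1, b1.2, b2.1, b2.2, b3.1, b3.2, b4.1, b4.2,
    c1.1, c1.2, c2.1, c2.2, c3.1, c3.2, c4.1, c4.2, s1, s2, s3, s4, s5, s6, s7]

/-- **Berger–Karcher estimate, four vectors (crude constant).** Under the sectional pinching
`|Rm(X,Y,Y,X) - c| ≤ ε` on `g_x`-orthonormal pairs, every quadruple of pairwise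
`g_x`-orthonormal vectors has `|Rm(X, Y, Z, W)| ≤ 8ε`: the polarisation step in the three
arrangements `(Y,Z,W)`, `(Z,W,Y)`, `(W,Y,Z)` bounds the pairwise differences of
`A = Rm(X,Y,Z,W)`, `B = Rm(X,Z,W,Y)`, `C = Rm(X,W,Y,Z)` by `12ε`, and the first Bianchi identity
gives `A + B + C = 0`, whence `3|A| ≤ 24ε`. (Karcher 1970: sharp constant `⅔(Δ - δ)`.)
[folklore] -/
theorem abs_curvatureForm_four_le (h : g.IsLeviCivita cov) (hn : 2 ≤ n)
    (hpos : ∀ v : TangentSpace I x, v ≠ 0 → 0 < g.val x v v)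
    (hK : ∀ X Y : TangentSpace I x, g.val x X X = 1 → g.val x Y Y = 1 → g.val x X Y = 0 →
      |g.curvatureForm cov x X Y Y X - c| ≤ ε)
    {X Y Z W : TangentSpace I x} (hX : g.val x X X = 1) (hY : g.val x Y Y = 1)
    (hZ : g.val x Z Z = 1) (hW : g.val x W W = 1) (hXY : g.val x X Y = 0)
    (hXZ : g.val x X Z = 0) (hXW : g.val x X W = 0) (hYZ : g.val x Y Z = 0)
    (hYW : g.val x Y W = 0) (hZW : g.val x Z W = 0) :
    |g.curvatureForm cov x X Y Z W| ≤ 8 * ε := by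
  have hZY : g.val x Z Y = 0 := by rw [g.symm]; exact hYZ
  have hWY : g.val x W Y = 0 := by rw [g.symm]; exact hYW
  have hWZ : g.val x W Z = 0 := by rw [g.symm]; exact hZW
  have e1 := abs_le.1
    (abs_curvatureForm_four_sub_le h hn hpos hK hX hY hZ hW hXY hXZ hXW hYZ hYW hZW)
  have e2 := abs_le.1
    (abs_curvatureForm_four_sub_le h hn hpos hK hX hZ hW hY hXZ hXW hXY hZW hZY hWY)
  have e3 := abs_le.1
    (abs_curvatureForm_four_sub_le h hn hpos hK hX hW hY hZ hXW hXY hXZ hWY hWZ hYZ)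
  -- first Bianchi identity `A + C + B = 0`
  have hB : g.curvatureForm cov x X Y Z W + g.curvatureForm cov x X W Y Z +
      g.curvatureForm cov x X Z W Y = 0 := by
    have hc := h.val_curvature_cyclic hn x X Y Z W
    simp only [curvatureForm]
    rw [h.val_curvature_pair_symm hn x X W Y Z, val_curvature_antisymm x X Z W Y,
      h.val_curvature_skew hn x Z X W Y, neg_neg]
    exact hc
  rw [abs_le]
  constructor <;> linarith [e1.1, e1.2, e2.1, e2.2, e3.1, e3.2]

/-! ### All components in an orthonormal frame -/

omit [FiniteDimensional ℝ E] [CompleteSpace E] in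
/-- `Rm(X, X, Z, W) = 0` (antisymmetry in the first pair; any connection). [folklore] -/
theorem curvatureForm_self_left (x : M) (X Z W : TangentSpace I x) :
    g.curvatureForm cov x X X Z W = 0 := by
  simp [curvatureForm]

/-- `Rm(X, Y, Z, Z) = 0` for a Levi-Civita connection (skew-adjointness, O'Neill 1983, Ch. 3,
Prop. 3.36 (2)). [cite: ONeill1983, Ch. 3, Prop. 3.36 (2), p. 75] -/
theorem curvatureForm_self_right (h : g.IsLeviCivita cov) (hn : 2 ≤ n) (x : M)
    (X Y Z : TangentSpace I x) : g.curvatureForm cov x X Y Z Z = 0 := by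
  have := h.val_curvature_skew hn x X Y Z Z
  simp only [curvatureForm]
  linarith

/-- **Sectional pinching bounds every orthonormal-frame component of `Rm - c (g ∧ g)/2`.** If
`g_x` is positive definite, `cov` is a Levi-Civita connection of the `C^n` metric `g` (`n ≥ 2`),
`0 ≤ ε`, and `|Rm(X,Y,Y,X) - c| ≤ ε` for every `g_x`-orthonormal pair, then for every
`g_x`-orthonormal frame `e` and all indices
`|Rm(eᵢ, eⱼ, e_k, e_l) - c (δ_il δ_jk - δ_ik δ_jl)| ≤ 8ε` — the components of the constant
curvature tensor `c (g(Y,Z) g(X,W) - g(X,Z) g(Y,W))` (Lee 2018, Prop. 8.36) being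
`c (δ_jk δ_il - δ_ik δ_jl)`. Case analysis on the coincidences among `i, j, k, l`: repeated index in
a pair gives `0`, the patterns `ijji`/`ijij` are the hypothesis, one repeated index is the
three-vector estimate, four distinct indices the four-vector estimate. (Berger 1960 /
Karcher 1970 with sharp constants.) [folklore] -/
theorem abs_curvatureForm_frame_sub_le (h : g.IsLeviCivita cov) (hn : 2 ≤ n)
    (hpos : ∀ v : TangentSpace I x, v ≠ 0 → 0 < g.val x v v) (hε : 0 ≤ ε)
    (hK : ∀ X Y : TangentSpace I x, g.val x X X = 1 → g.val x Y Y = 1 → g.val x X Y = 0 →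
      |g.curvatureForm cov x X Y Y X - c| ≤ ε)
    {ι : Type*} [DecidableEq ι] {e : ι → TangentSpace I x} (he : g.IsOrthonormalFrame x e)
    (i j k l : ι) :
    |g.curvatureForm cov x (e i) (e j) (e k) (e l) -
        c * ((if i = l then 1 else 0) * (if j = k then 1 else 0) -
          (if i = k then 1 else 0) * (if j = l then 1 else 0))| ≤ 8 * ε := by
  by_cases hij : i = j
  · subst hij
    rw [curvatureForm_self_left]
    by_cases hik : i = k <;> by_cases hil : i = l <;> simp [hik, hil] <;> linarith
  by_cases hkl : k = l
  · subst hkl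
    rw [curvatureForm_self_right h hn]
    by_cases hik : i = k <;> by_cases hjk : j = k <;> simp [hik, hjk] <;> linarith
  by_cases hik : i = k
  · subst hik
    have hil : i ≠ l := hkl
    by_cases hjl : j = l
    · subst hjl
      -- `Rm(e_i, e_j, e_i, e_j) = -Rm(e_i, e_j, e_j, e_i)`
      have hb := abs_le.1 (hK (e i) (e j) (he.1 i) (he.1 j) (he.2 i j hij))
      have hs : g.curvatureForm cov x (e i) (e j) (e i) (e j) =
          - g.curvatureForm cov x (e i) (e j) (e j) (e i) := by
        simp only [curvatureForm]; rw [h.val_curvature_skew hn x (e i) (e j) (e i) (e j)]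
      simp only [if_neg hij, if_true, hs]
      rw [abs_le]; constructor <;> linarith
    · have hb := abs_curvatureForm_three_le' h hn hpos hK (he.1 i) (he.1 j) (he.1 l)
        (he.2 i j hij) (he.2 i l hil) (he.2 j l hjl)
      simp only [if_neg hil, if_neg hjl, if_true]
      norm_num
      linarith [hb]
  by_cases hil : i = l
  · subst hil
    by_cases hjk : j = k
    · subst hjk
      have hb := hK (e i) (e j) (he.1 i) (he.1 j) (he.2 i j hij)
      simp only [if_neg hij, if_true]
      norm_num
      linarith [hb]
    · have hb := abs_curvatureForm_three_le h hn hpos hK (he.1 i) (he.1 j) (he.1 k)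
        (he.2 i j hij) (he.2 i k hik) (he.2 j k hjk)
      simp only [if_neg hik, if_neg hjk, if_true]
      norm_num
      linarith [hb]
  by_cases hjk : j = k
  · subst hjk
    have hjl : j ≠ l := hkl
    have hb := abs_curvatureForm_three_le_mid h hn hpos hK (he.1 i) (he.1 j) (he.1 l)
      (he.2 i j hij) (he.2 i l hil) (he.2 j l hjl)
    simp only [if_neg hil, if_neg hij, if_neg hjl, if_true]
    norm_num
    linarith [hb]
  by_cases hjl : j = l
  · subst hjl
    have hb := abs_curvatureForm_three_le_mid' h hn hpos hK (he.1 i) (he.1 j) (he.1 k)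
      (he.2 i j hij) (he.2 i k hik) (he.2 j k hjk)
    simp only [if_neg hij, if_neg hik, if_neg hjk, if_true]
    norm_num
    linarith [hb]
  · have hb := abs_curvatureForm_four_le h hn hpos hK (he.1 i) (he.1 j) (he.1 k) (he.1 l)
      (he.2 i j hij) (he.2 i k hik) (he.2 i l hil) (he.2 j k hjk) (he.2 j l hjl) (he.2 k l hkl)
    simp only [if_neg hil, if_neg hik, if_neg hjk, if_neg hjl]
    norm_num
    exact hb

end LeviCivita

end Literature.Geometry.Riemannian

end
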